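import Summits.NavierStokesRegularity.FluidComputer.BlockRelReach
import Summits.NavierStokesRegularity.FluidComputer.BlockReachRigidity

/-!
# Block line — the relative residue of the quadratic transit design is VOID: the junk-rate law at
# the clean states forces `κ_{n+1} = 0`, the coupling law then forces `k = 0`

HONEST FRAMING: low prior, high value-of-information experiment on Tao's machine paradigm; NOT a
claim that NS blows up. This file is a NO-GO, by the lane's own hand, for the residue AS RE-TYPED
in `BlockRelReach.lean` (relative tolerance): `RelOpenReachBound 𝒟 P (quadVF k η) (loadedRegion η)
ε τc` is UNINHABITED for every wavelet data `𝒟`, specs `S`, parameters `P`, `ε`, `τc`, every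
`η > 0` and every `k ≠ 0` (`not_relOpenReachBound_quad`); in particular the hypothesis of
`ns_blowup_of_relQuadReachBound` (`BlockRelTransit.lean`, `k ≥ 6`) is empty. Nothing here is
evidence about Navier–Stokes in either direction; no design-level theorem of the lane is touched.

MECHANISM (all [folklore] given the landed two-mode calculus of `BlockReachCalculus.lean` /
`BlockReachRigidity.lean`): the clean design states `recon n p` (readout `p`, junk ZERO) are
guarded `H¹⁰_df` data, so BOTH dynamical fields of an inhabitant can be tested at `t = 0` along
their true mild Navier–Stokes trajectories. (§1) Off-design modes are junk-visible:
`(2ᵐ/λ_n)^s |⟨v, ψ_m⟩| ≤ junk n v`, `m ∉ {n, n+1}` (landed `mul_enorm_pairing_le_J`). (§3) `defect`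
⇒ RELATIVE RIGIDITY `‖unit n • nsVF n p - F p‖ ≤ ε (1 + ‖p‖)` on `U` (landed
`hasDerivWithinAt_read_clean`), hence on a clean input ray with `(F (A,0)).2 = k A²` the EXACT
COUPLING LAW `k = unit n · E_n κ_n / √E_{n+1}`, `κ_n = fwdCoef 𝒟 n = Re⟨B(ψ_n,ψ_n),ψ_{n+1}⟩`
(the relative port of 98's rigidity: `A²` beats `ε (1 + A)`). (§4) `junk_rate` ⇒ the JUNK-RATE
BUDGET at every clean state `p ∈ U` (new; involves neither `F` nor `ε`):
`(2ᵐ/λ_n)^s |⟨B(recon n p, recon n p), ψ_m⟩| ≤ 2 (γ+1) √E_n / unit n`, `m ∉ {n, n+1}` — the true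
flow deposits `⟨u t, ψ_m⟩ = ⟨B(recon n p, recon n p), ψ_m⟩ t + o(t)` (landed
`hasDerivWithinAt_coef_clean`), junk-visible by §1, while `junk_rate` at `t = 0` (`ρ = γ + 1`)
allows, frequently as `t → 0⁺`, only `junk n (u t) ≤ (γ+1) √E_n t / unit n`: an AMPLITUDE-UNIFORM
budget against a deposit QUADRATIC in the amplitude. (§5) So on a clean input ray
`⟨B(ψ_n,ψ_n),ψ_m⟩ = 0`, and on a clean OUTPUT ray `{(0,B) : B ≥ B₀} ⊆ U`:
`⟨B(ψ_{n+1},ψ_{n+1}),ψ_m⟩ = 0` for all `m ∉ {n, n+1}`; `m = n+2` gives `κ_{n+1} = 0` — the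
machine's OWN next transfer `ψ_{n+1}ψ_{n+1} → ψ_{n+2}` is block-`n` junk production, unbounded
along the output ray. (§6) `loadedRegion η ∋ (0, B)` for `B ≥ 2/η + 1`; so `κ_{n+1} = 0 ∀ n`, and
the coupling law at generation `1` reads `k = unit 1 · E_1 · 0 / √E_2 = 0`.

HONEST READING. (1) WHAT DIED: the typing (T3-rel) of `BlockRelReach.lean`/`BlockRelTransit.lean`
— not the quadratic transit DESIGN (its certificates 94/112 stand) and not the machine paradigm.
(2) WHY, in one line: `BlockRelReach.lean` made the readout DEFECT amplitude-relative but
inherited `junk_rate` VERBATIM from `OpenReachBound` — an amplitude-UNIFORM production budget on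
a working region unbounded along the output axis, where the cascade's own next pump acts; it is
the junk-rate twin of the amplitude artefact recorded in `BlockReachProbe.lean` /
`BlockPairCeiling.lean` for `defect`. The same theorem kills the junk-rate field of every earlier
typing with that field and that region (they were already dead by other hands). (3) WHAT A
SUCCESSOR MUST CHANGE (not done here; each is a re-typing, none is claimed to work): (a) bound
the working region along the output axis (the transit ends at `b ≤ b_max`; handoff must then
re-read the state at generation `n+1` before `B` grows) — §4 then leaves the QUANTITATIVE
constraint `(2ⁿ⁺²/λ_n)^s E_{n+1} κ_{n+1} B² ≤ 2(γ+1)√E_n/unit n` on it (with the coupling law at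
`n+1`: a bound on the clock ratio `unit n / unit (n+1)`); or (b) make
`junk_rate` amplitude-relative as well; or (c) charge the next pump to block `n+1`'s readout
instead of block `n`'s junk (a two-block bookkeeping the present `VarReachCircuit` lacks).
(4) The exact identities of §5 on the input ray (`⟨B(ψ_n,ψ_n),ψ_m⟩ = 0`, `m ≤ n-2`) survive any
such re-typing that keeps an unbounded input ray and an amplitude-uniform junk rate.
-/

noncomputable section

open MeasureTheory Set Filter Topology Metric Asymptotics
open scoped ENNReal NNReal

namespace Summit.NavierStokesRegularity.FluidComputer

open Literature.Analysis.FluidPDE Literature.Analysis.FluidPDE.Tao2016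
open Literature.Analysis.FluidPDE.FluidComputer
open Literature.Analysis.FunctionSpaces (eFourierSobolevNorm)
open Summit.NavierStokesRegularity.NavierStokesRegularity.Theorems.FluidComputer
open Summit.NavierStokesRegularity.NavierStokesRegularity.Theorems.PerpetualPumpEulerTypeIGlue
  (eulerForm_smul_smul)

namespace BlockDesign

/-! ### §1. Off-design modes are junk-visible -/

section OffMode

variable (𝒟 : CascadeWaveletData 1 1) (S : CascadeSpecs)

/-- Design states of block `n` have no coefficient on `ψ_m`, `m ∉ {n, n+1}`. [folklore] -/
theorem coef_recon_of_ne (n : ℕ) {m : ℕ} (h : m ≠ n) (h1 : m ≠ n + 1) (p : ℝ × ℝ) :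
    coef 𝒟 m (recon 𝒟 S n p) = 0 := by
  rw [coef_recon, if_neg (Ne.symm h), if_neg (Ne.symm h1), add_zero]

/-- The junk weight is at least `(2ᵐ/λ_n)^s` on the frequency region of `ψ_m` (`|ξ| > 2ᵐ` there,
`s ≥ 0`). [folklore] -/
theorem weight_floor_of_mem_region (n m : ℕ) (μ : ℝ) {s : ℝ} (hs : 0 ≤ s)
    {ξ : EuclideanSpace ℝ (Fin 3)} (hξ : ξ ∈ freqRegion 𝒟 0 (m : ℤ)) :
    ((2 : ℝ) ^ m / S.lam n) ^ s ≤ (max ‖ξ‖ μ / S.lam n) ^ s := by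
  have hl := S.lam_pos n
  refine Real.rpow_le_rpow (by positivity) ?_ hs
  exact div_le_div_of_nonneg_right
    ((norm_of_mem_region 𝒟 m hξ).1.le.trans (le_max_left _ _)) hl.le

variable {S} (P : Params S)

/-- **Off-design coefficients are junk-visible**: `(2ᵐ/λ_n)^s |⟨v, ψ_m⟩| ≤ junk n v` for
`m ∉ {n, n+1}` (every design state `recon n p` is invisible to `ψ_m`, and the junk weight has the
floor `(2ᵐ/λ_n)^s` on the region of `ψ_m`; landed `mul_enorm_pairing_le_J`). [folklore] -/
theorem floor_mul_enorm_coef_le_junk (n : ℕ) {m : ℕ} (h : m ≠ n) (h1 : m ≠ n + 1) (v : L2C) :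
    ENNReal.ofReal (((2 : ℝ) ^ m / S.lam n) ^ P.s) * ‖coef 𝒟 m v‖ₑ ≤ junk 𝒟 P n v := by
  refine le_iInf fun p => ?_
  have hc : coef 𝒟 m v = coef 𝒟 m (v - recon 𝒟 S n p) := by
    rw [coef_sub, coef_recon_of_ne 𝒟 S n h h1, sub_zero]
  rw [hc]
  exact mul_enorm_pairing_le_J 𝒟 two_pos' 0 (m : ℤ)
    (fun ξ hξ => weight_floor_of_mem_region 𝒟 S n m P.μ P.s_nonneg hξ) _

end OffMode

/-! ### §2. Two calculus lemmas -/

section Elementary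

/-- A curve with `f 0 = 0` and right derivative `D` at `0` satisfies `‖D‖/2 · t ≤ ‖f t‖` for all
small `t > 0`. [folklore] -/
theorem eventually_norm_ge_of_hasDerivWithinAt {f : ℝ → ℂ} {D : ℂ}
    (hf : HasDerivWithinAt f D (Ici 0) 0) (h0 : f 0 = 0) :
    ∀ᶠ t in 𝓝[>] (0 : ℝ), ‖D‖ / 2 * t ≤ ‖f t‖ := by
  rcases eq_or_ne D 0 with rfl | hD
  · exact Eventually.of_forall fun t => by simp
  have hD2 : 0 < ‖D‖ / 2 := by positivity
  have h1 : ∀ᶠ t in 𝓝[≥] (0 : ℝ), ‖f t - f 0 - (t - 0) • D‖ ≤ ‖D‖ / 2 * ‖t - 0‖ :=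
    (hasDerivWithinAt_iff_isLittleO.1 hf).def hD2
  have h2 : ∀ᶠ t in 𝓝[>] (0 : ℝ), ‖f t - f 0 - (t - 0) • D‖ ≤ ‖D‖ / 2 * ‖t - 0‖ :=
    h1.filter_mono (nhdsWithin_mono _ Ioi_subset_Ici_self)
  filter_upwards [h2, self_mem_nhdsWithin] with t ht htpos
  have htp : 0 < t := htpos
  rw [h0, sub_zero, sub_zero, Real.norm_eq_abs, abs_of_pos htp] at ht
  have hn : ‖t • D‖ = t * ‖D‖ := by rw [norm_smul, Real.norm_eq_abs, abs_of_pos htp]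
  have htri : ‖t • D‖ - ‖f t‖ ≤ ‖f t - t • D‖ := by
    rw [← norm_sub_rev (t • D) (f t)]
    exact norm_sub_norm_le _ _
  linarith

/-- If `|γ| A² ≤ ε (1 + A)` for all `A ≥ A₀` then `γ = 0`. [folklore] -/
theorem eq_zero_of_abs_mul_sq_le {γ ε A₀ : ℝ}
    (h : ∀ A : ℝ, A₀ ≤ A → |γ| * A ^ 2 ≤ ε * (1 + A)) : γ = 0 := by
  by_contra hγ
  have hg : 0 < |γ| := abs_pos.2 hγ
  set A : ℝ := max (max A₀ 1) (2 * |ε| / |γ| + 1) with hA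
  have hA₀ : A₀ ≤ A := (le_max_left _ _).trans (le_max_left _ _)
  have hA1 : 1 ≤ A := (le_max_right _ _).trans (le_max_left _ _)
  have hAq : 2 * |ε| / |γ| + 1 ≤ A := le_max_right _ _
  have h1 := h A hA₀
  have h2 : |γ| * A ^ 2 ≤ 2 * |ε| * A := by
    have : ε * (1 + A) ≤ |ε| * (1 + A) := mul_le_mul_of_nonneg_right (le_abs_self ε) (by linarith)
    nlinarith [abs_nonneg ε]
  have h3 : |γ| * A ≤ 2 * |ε| := by nlinarith
  have h4 : (2 * |ε| / |γ| + 1) * |γ| ≤ A * |γ| := mul_le_mul_of_nonneg_right hAq hg.le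
  rw [add_mul, div_mul_cancel₀ _ hg.ne', one_mul] at h4
  nlinarith

/-- If `c ≥ 0` and `c A² ≤ C` for all `A ≥ A₀` then `c = 0`. [folklore] -/
theorem eq_zero_of_nonneg_mul_sq_le {c C A₀ : ℝ} (hc : 0 ≤ c)
    (h : ∀ A : ℝ, A₀ ≤ A → c * A ^ 2 ≤ C) : c = 0 :=
  eq_zero_of_abs_mul_sq_le (ε := |C|) (A₀ := max A₀ 0) fun A hA => by
    have h1 := h A ((le_max_left _ _).trans hA)
    have hA0 : 0 ≤ A := (le_max_right _ _).trans hA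
    rw [abs_of_nonneg hc]
    nlinarith [le_abs_self C, abs_nonneg C]

end Elementary

/-! ### §3. `defect` at the clean states: relative rigidity and the exact coupling law -/

section Rigidity

variable {𝒟 : CascadeWaveletData 1 1} {S : CascadeSpecs} {P : Params S}
variable {F : ℝ × ℝ → ℝ × ℝ} {U : Set (ℝ × ℝ)} {ε τc : ℝ}

/-- **RELATIVE RIGIDITY**: an inhabitant forces `‖unit n • nsVF n p - F p‖ ≤ ε (1 + ‖p‖)` at
every `p ∈ U`, every `n` (`defect` at `t = 0` from the clean state `recon n p`, whose readout
derivative IS `nsVF n p` — landed `hasDerivWithinAt_read_clean` — unique on `[0, ∞)`). [folklore] -/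
theorem RelOpenReachBound.norm_unit_smul_nsVF_sub_le (H : RelOpenReachBound 𝒟 P F U ε τc)
    (n : ℕ) {p : ℝ × ℝ} (hp : p ∈ U) : ‖H.unit n • nsVF 𝒟 S n p - F p‖ ≤ relMod ε p := by
  have ha : MemH10df (recon 𝒟 S n p) := memH10df_recon 𝒟 S n _
  obtain ⟨T, hT, u, hu⟩ := h10MildTheory_holds.localExistence _ ha
  have hu0 : u 0 = recon 𝒟 S n p := initial_eq hu ⟨le_rfl, hT⟩ ha
  have hread : read 𝒟 S n (u 0) = p := by rw [hu0, read_recon]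
  have hjunk : junk 𝒟 P n (u 0) < ENNReal.ofReal (H.jbar * Real.sqrt (S.Emin n)) := by
    rw [hu0, junk_recon]
    exact ENNReal.ofReal_pos.2 (mul_pos (P.jrun_pos.trans H.jrun_lt_jbar) (sqrt_Emin_pos S n))
  obtain ⟨W, hW, hWε⟩ := H.defect n _ T u hu 0 le_rfl hT (hread ▸ hp) hjunk
  have hEq : W = nsVF 𝒟 S n p :=
    (uniqueDiffOn_Ici (0 : ℝ) 0 (Set.mem_Ici.2 le_rfl)).eq_deriv _ hW
      (hasDerivWithinAt_read_clean 𝒟 S n p hT hu)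
  rw [hread, hEq] at hWε
  exact hWε

/-- Relative rigidity, output component. [folklore] -/
theorem RelOpenReachBound.abs_snd_le (H : RelOpenReachBound 𝒟 P F U ε τc) (n : ℕ) {p : ℝ × ℝ}
    (hp : p ∈ U) : |H.unit n * (nsVF 𝒟 S n p).2 - (F p).2| ≤ relMod ε p := by
  have h := (norm_snd_le _).trans (H.norm_unit_smul_nsVF_sub_le n hp)
  simpa [Real.norm_eq_abs] using h

/-- `‖(A, 0)‖ = A` for `A ≥ 0`. [folklore] -/
theorem norm_inputRay {A : ℝ} (hA : 0 ≤ A) : ‖((A, 0) : ℝ × ℝ)‖ = A := by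
  simp only [Prod.norm_def, Real.norm_eq_abs, abs_zero, abs_of_nonneg hA, max_eq_left hA]

/-- **THE EXACT COUPLING LAW**: if `{(A,0) : A ≥ A₀} ⊆ U` and `(F (A,0)).2 = k A²` there, then
`k = unit n · E_n κ_n / √E_{n+1}` for every `n` (`|unit n (A√E_n)² κ_n/√E_{n+1} - k A²| ≤ ε (1+A)`
and `A²` wins). The relative port of `OpenReachBound.coupling_eq`. [folklore] -/
theorem RelOpenReachBound.coupling_eq (H : RelOpenReachBound 𝒟 P F U ε τc) (n : ℕ) {A₀ k : ℝ}
    (hU : ∀ A : ℝ, A₀ ≤ A → ((A, 0) : ℝ × ℝ) ∈ U)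
    (hF : ∀ A : ℝ, A₀ ≤ A → (F (A, 0)).2 = k * A ^ 2) :
    k = H.unit n * S.Emin n * fwdCoef 𝒟 n / Real.sqrt (S.Emin (n + 1)) := by
  have hEn : Real.sqrt (S.Emin n) ^ 2 = S.Emin n := Real.sq_sqrt (S.Emin_pos n).le
  refine (sub_eq_zero.1 (eq_zero_of_abs_mul_sq_le (A₀ := max A₀ 0) (ε := ε) fun A hA => ?_)).symm
  have hA₀ : A₀ ≤ A := (le_max_left _ _).trans hA
  have hA0 : 0 ≤ A := (le_max_right _ _).trans hA
  have h := H.abs_snd_le n (hU A hA₀)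
  rw [nsVF_input_ray, hF A hA₀, relMod, norm_inputRay hA0] at h
  have hq : H.unit n * ((A * Real.sqrt (S.Emin n)) ^ 2 * fwdCoef 𝒟 n /
      Real.sqrt (S.Emin (n + 1))) - k * A ^ 2 =
      (H.unit n * S.Emin n * fwdCoef 𝒟 n / Real.sqrt (S.Emin (n + 1)) - k) * A ^ 2 := by
    rw [mul_pow, hEn]; ring
  rw [hq, abs_mul, abs_of_nonneg (sq_nonneg A)] at h
  exact h

end Rigidity

/-! ### §4. `junk_rate` at the clean states: the junk-rate budget -/

section JunkRate

variable {𝒟 : CascadeWaveletData 1 1} {S : CascadeSpecs} {P : Params S}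
variable {F : ℝ × ℝ → ℝ × ℝ} {U : Set (ℝ × ℝ)} {ε τc : ℝ}

/-- **THE JUNK-RATE BUDGET at a clean state.** An inhabitant of `RelOpenReachBound 𝒟 P F U ε τc`
forces, at every `p ∈ U`, every block `n` and every off-design mode `m ∉ {n, n+1}`:
`(2ᵐ/λ_n)^s · |⟨B(recon n p, recon n p), ψ_m⟩| ≤ 2 (γ+1) √E_n / unit n` (`⟨u t, ψ_m⟩` starts at `0`
with right derivative `⟨B(recon n p, recon n p), ψ_m⟩` — landed `hasDerivWithinAt_coef_clean` — and
is junk-visible, §1–§2; `junk_rate` at `t = 0` with `ρ = γ + 1`). Neither `F` nor `ε` enters.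
[folklore] -/
theorem RelOpenReachBound.floor_mul_norm_eulerForm_recon_le (H : RelOpenReachBound 𝒟 P F U ε τc)
    (n : ℕ) {m : ℕ} (hm : m ≠ n) (hm1 : m ≠ n + 1) {p : ℝ × ℝ} (hp : p ∈ U) :
    ((2 : ℝ) ^ m / S.lam n) ^ P.s * ‖eulerForm (recon 𝒟 S n p) (recon 𝒟 S n p) (mode 𝒟 m)‖ ≤
      2 * ((H.γ + 1) * Real.sqrt (S.Emin n) / H.unit n) := by
  have hun := H.unit_pos n
  have hsE := sqrt_Emin_pos S n
  -- the true trajectory from the clean state; the junk-rate law at `t = 0` with `ρ = γ + 1`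
  have ha : MemH10df (recon 𝒟 S n p) := memH10df_recon 𝒟 S n _
  obtain ⟨T, hT, u, hu⟩ := h10MildTheory_holds.localExistence _ ha
  have hu0 : u 0 = recon 𝒟 S n p := initial_eq hu ⟨le_rfl, hT⟩ ha
  have hread : read 𝒟 S n (u 0) = p := by rw [hu0, read_recon]
  have hjunk : junk 𝒟 P n (u 0) < ENNReal.ofReal (H.jbar * Real.sqrt (S.Emin n)) := by
    rw [hu0, junk_recon]
    exact ENNReal.ofReal_pos.2 (mul_pos (P.jrun_pos.trans H.jrun_lt_jbar) (sqrt_Emin_pos S n))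
  have hfr := H.junk_rate n _ T u hu 0 le_rfl hT (hread ▸ hp) hjunk (H.γ + 1) (lt_add_one _)
  -- the off-design coefficient: zero at `t = 0`, right derivative `⟨B(recon n p, recon n p), ψ_m⟩`
  have hc0 : coef 𝒟 m (u 0) = 0 := by rw [hu0, coef_recon_of_ne 𝒟 S n hm hm1]
  have hder := hasDerivWithinAt_coef_clean 𝒟 S n m p hT hu
  rw [coef_recon_of_ne 𝒟 S n hm hm1, zero_mul, zero_add] at hder
  have hev := eventually_norm_ge_of_hasDerivWithinAt hder hc0
  set D := eulerForm (recon 𝒟 S n p) (recon 𝒟 S n p) (mode 𝒟 m) with hD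
  set M : ℝ := ((2 : ℝ) ^ m / S.lam n) ^ P.s with hM
  have hM0 : 0 < M := Real.rpow_pos_of_pos (div_pos (pow_pos two_pos _) (S.lam_pos n)) _
  set r : ℝ := (H.γ + 1) * Real.sqrt (S.Emin n) / H.unit n with hr
  have hr0 : 0 ≤ r := by have := H.γ_nonneg; positivity
  obtain ⟨t, hjt, hlow, htpos⟩ := (hfr.and_eventually (hev.and self_mem_nhdsWithin)).exists
  have ht : 0 < t := htpos
  rw [hu0, junk_recon, zero_add, sub_zero] at hjt
  -- chain: `M (‖D‖/2) t ≤ M |⟨u t, ψ_m⟩| ≤ junk n (u t) ≤ (γ+1) √E_n t / unit n = r t`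
  have hrt : (H.γ + 1) * Real.sqrt (S.Emin n) * (t / H.unit n) = r * t := by rw [hr]; ring
  have hchain : ENNReal.ofReal (M * (‖D‖ / 2 * t)) ≤ ENNReal.ofReal (r * t) :=
    calc ENNReal.ofReal (M * (‖D‖ / 2 * t))
        = ENNReal.ofReal M * ENNReal.ofReal (‖D‖ / 2 * t) := ENNReal.ofReal_mul hM0.le
      _ ≤ ENNReal.ofReal M * ‖coef 𝒟 m (u t)‖ₑ := by
          rw [← ofReal_norm]
          exact mul_le_mul' le_rfl (ENNReal.ofReal_le_ofReal hlow)
      _ ≤ junk 𝒟 P n (u t) := floor_mul_enorm_coef_le_junk 𝒟 P n hm hm1 (u t)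
      _ ≤ ENNReal.ofReal ((H.γ + 1) * Real.sqrt (S.Emin n) * (t / H.unit n)) := hjt
      _ = ENNReal.ofReal (r * t) := by rw [hrt]
  have hreal : M * (‖D‖ / 2 * t) ≤ r * t :=
    (ENNReal.ofReal_le_ofReal_iff (by positivity)).1 hchain
  have h3 : M * ‖D‖ / 2 * t ≤ r * t := by
    have : M * (‖D‖ / 2 * t) = M * ‖D‖ / 2 * t := by ring
    linarith
  have h4 : M * ‖D‖ / 2 ≤ r := le_of_mul_le_mul_right h3 ht
  linarith

/-- **Vanishing along a clean ray** `q A ∈ U` (`A ≥ A₀`) of pure modes `recon n (q A) = (A c) ψ`,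
`c > 0`: `⟨B(ψ, ψ), ψ_m⟩ = 0` for `m ∉ {n, n+1}` (the budget is amplitude-uniform). [folklore] -/
theorem RelOpenReachBound.eulerForm_eq_zero_of_ray (H : RelOpenReachBound 𝒟 P F U ε τc) (n : ℕ)
    {m : ℕ} (hm : m ≠ n) (hm1 : m ≠ n + 1) {ψ : L2C} {c A₀ : ℝ} (hc : 0 < c) {q : ℝ → ℝ × ℝ}
    (hU : ∀ A : ℝ, A₀ ≤ A → q A ∈ U)
    (hq : ∀ A : ℝ, recon 𝒟 S n (q A) = (((A * c : ℝ)) : ℂ) • ψ) :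
    eulerForm ψ ψ (mode 𝒟 m) = 0 := by
  obtain ⟨B, hB⟩ : ∃ B, eulerForm ψ ψ (mode 𝒟 m) = B := ⟨_, rfl⟩
  obtain ⟨M, hM⟩ : ∃ M : ℝ, ((2 : ℝ) ^ m / S.lam n) ^ P.s = M := ⟨_, rfl⟩
  have hM0 : 0 < M := by
    rw [← hM]; exact Real.rpow_pos_of_pos (div_pos (pow_pos two_pos _) (S.lam_pos n)) _
  rw [hB]
  have key : ∀ A : ℝ, A₀ ≤ A →
      M * c ^ 2 * ‖B‖ * A ^ 2 ≤ 2 * ((H.γ + 1) * Real.sqrt (S.Emin n) / H.unit n) := by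
    intro A hA
    have h := H.floor_mul_norm_eulerForm_recon_le n hm hm1 (hU A hA)
    rw [hq A, eulerForm_smul_smul, ← Complex.ofReal_pow, norm_mul, Complex.norm_real,
      Real.norm_eq_abs, abs_of_nonneg (sq_nonneg _), mul_pow, hB, hM] at h
    have : M * (A ^ 2 * c ^ 2 * ‖B‖) = M * c ^ 2 * ‖B‖ * A ^ 2 := by ring
    linarith
  have h0 := eq_zero_of_nonneg_mul_sq_le (by positivity : 0 ≤ M * c ^ 2 * ‖B‖) key
  have hMc : M * c ^ 2 ≠ 0 := (mul_pos hM0 (pow_pos hc 2)).ne'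
  rcases mul_eq_zero.1 h0 with h1 | h1
  · exact absurd h1 hMc
  · exact norm_eq_zero.1 h1

end JunkRate

/-! ### §5. The clean input and output rays -/

section Rays

variable {𝒟 : CascadeWaveletData 1 1} {S : CascadeSpecs} {P : Params S}
variable {F : ℝ × ℝ → ℝ × ℝ} {U : Set (ℝ × ℝ)} {ε τc : ℝ}

/-- **Input ray**: if `{(A,0) : A ≥ A₀} ⊆ U` then `⟨B(ψ_n, ψ_n), ψ_m⟩ = 0` for all
`m ∉ {n, n+1}` — exact identities on the wavelet data (automatic by Fourier supports for
`m ≥ n+2` and `m = n-1`, genuine for `m ≤ n-2`). [folklore] -/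
theorem RelOpenReachBound.eulerForm_in_eq_zero (H : RelOpenReachBound 𝒟 P F U ε τc) {n m : ℕ}
    (hm : m ≠ n) (hm1 : m ≠ n + 1) {A₀ : ℝ} (hU : ∀ A : ℝ, A₀ ≤ A → ((A, 0) : ℝ × ℝ) ∈ U) :
    eulerForm (mode 𝒟 n) (mode 𝒟 n) (mode 𝒟 m) = 0 :=
  H.eulerForm_eq_zero_of_ray n hm hm1 (sqrt_Emin_pos S n) hU fun A => recon_fst 𝒟 S n A

/-- **Output ray**: if `{(0,B) : B ≥ B₀} ⊆ U` then `⟨B(ψ_{n+1}, ψ_{n+1}), ψ_m⟩ = 0` for all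
`m ∉ {n, n+1}`. [folklore] -/
theorem RelOpenReachBound.eulerForm_out_eq_zero (H : RelOpenReachBound 𝒟 P F U ε τc) {n m : ℕ}
    (hm : m ≠ n) (hm1 : m ≠ n + 1) {B₀ : ℝ} (hU : ∀ B : ℝ, B₀ ≤ B → ((0, B) : ℝ × ℝ) ∈ U) :
    eulerForm (mode 𝒟 (n + 1)) (mode 𝒟 (n + 1)) (mode 𝒟 m) = 0 :=
  H.eulerForm_eq_zero_of_ray n hm hm1 (sqrt_Emin_pos S (n + 1)) hU fun B => recon_snd 𝒟 S n B

/-- **THE NEXT PUMP IS BLOCK-`n` JUNK**: if `{(0,B) : B ≥ B₀} ⊆ U` then `κ_{n+1} =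
Re⟨B(ψ_{n+1}, ψ_{n+1}), ψ_{n+2}⟩ = 0` (`m = n+2` above). [folklore] -/
theorem RelOpenReachBound.fwdCoef_succ_eq_zero (H : RelOpenReachBound 𝒟 P F U ε τc) (n : ℕ)
    {B₀ : ℝ} (hU : ∀ B : ℝ, B₀ ≤ B → ((0, B) : ℝ × ℝ) ∈ U) : fwdCoef 𝒟 (n + 1) = 0 := by
  have h := H.eulerForm_out_eq_zero (n := n) (m := n + 1 + 1) (by omega) (by omega) hU
  show (eulerForm (mode 𝒟 (n + 1)) (mode 𝒟 (n + 1)) (mode 𝒟 (n + 1 + 1))).re = 0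
  rw [h, Complex.zero_re]

end Rays

/-! ### §6. The quadratic gate on the loaded region: `k = 0` -/

section Quad

variable {𝒟 : CascadeWaveletData 1 1} {S : CascadeSpecs} {P : Params S} {k η ε τc : ℝ}

/-- The loaded region contains the clean output ray `{(0, B) : B ≥ 2/η + 1}` (`η > 0`):
`η B² ≥ η B ≥ 2 + η > 2`. [folklore] -/
theorem mem_loadedRegion_out (hη : 0 < η) {B : ℝ} (hB : 2 / η + 1 ≤ B) :
    ((0, B) : ℝ × ℝ) ∈ loadedRegion η := by
  have h2η : 0 < 2 / η := div_pos two_pos hη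
  have h1 : 1 ≤ B := by linarith
  have hηB : 2 + η ≤ η * B := by
    have h := mul_le_mul_of_nonneg_left hB hη.le
    have he : η * (2 / η + 1) = 2 + η := by field_simp
    linarith
  show 2 < pairEnergy η (0, B)
  simp only [pairEnergy]
  nlinarith [mul_le_mul_of_nonneg_left h1 (by positivity : 0 ≤ η * B)]

/-- **THE COUPLING LAW for the quadratic gate on the loaded region**: an inhabited
`RelOpenReachBound 𝒟 P (quadVF k η) (loadedRegion η) ε τc` forces
`k = unit n · E_n κ_n / √E_{n+1}` at every generation `n` (input ray `A ≥ 2`). [folklore] -/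
theorem RelOpenReachBound.coupling_eq_quad
    (H : RelOpenReachBound 𝒟 P (quadVF k η) (loadedRegion η) ε τc) (n : ℕ) :
    k = H.unit n * S.Emin n * fwdCoef 𝒟 n / Real.sqrt (S.Emin (n + 1)) :=
  H.coupling_eq n (A₀ := 2) (fun _ hA => mem_loadedRegion_ray η hA) fun A _ => by simp [quadVF]

/-- **Every forward coefficient from generation `1` on vanishes**: an inhabited
`RelOpenReachBound 𝒟 P (quadVF k η) (loadedRegion η) ε τc` with `η > 0` forces `κ_{n+1} = 0`
for all `n` (output ray `B ≥ 2/η + 1`). [folklore] -/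
theorem RelOpenReachBound.fwdCoef_succ_eq_zero_quad
    (H : RelOpenReachBound 𝒟 P (quadVF k η) (loadedRegion η) ε τc) (hη : 0 < η) (n : ℕ) :
    fwdCoef 𝒟 (n + 1) = 0 :=
  H.fwdCoef_succ_eq_zero n (B₀ := 2 / η + 1) fun _ hB => mem_loadedRegion_out hη hB

/-- **THE RELATIVE RESIDUE OF THE QUADRATIC DESIGN FORCES `k = 0`**: coupling law at generation
`1` (`k = unit 1 · E_1 κ_1 / √E_2`) and `κ_1 = 0`. [folklore] -/
theorem RelOpenReachBound.quad_eq_zero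
    (H : RelOpenReachBound 𝒟 P (quadVF k η) (loadedRegion η) ε τc) (hη : 0 < η) : k = 0 := by
  have hc := H.coupling_eq_quad 1
  have h0 : fwdCoef 𝒟 1 = 0 := by simpa using H.fwdCoef_succ_eq_zero_quad hη 0
  rw [h0, mul_zero, zero_div] at hc
  exact hc

/-- **NO-GO ((T3-rel) as typed)**: for `η > 0`, `k ≠ 0` the structure `RelOpenReachBound 𝒟 P
(quadVF k η) (loadedRegion η) ε τc` is EMPTY for every `𝒟`, `S`, `P`, `ε`, `τc`; in particular
the hypothesis of `ns_blowup_of_relQuadReachBound` is. About the TYPING, not about NS. [folklore] -/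
theorem not_relOpenReachBound_quad (hη : 0 < η) (hk : k ≠ 0) :
    IsEmpty (RelOpenReachBound 𝒟 P (quadVF k η) (loadedRegion η) ε τc) :=
  ⟨fun H => hk (H.quad_eq_zero hη)⟩

end Quad

end BlockDesign

end Summit.NavierStokesRegularity.FluidComputer
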